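import Literature.MathematicalPhysics.QuantumFieldTheory.LatticeGaugeTorusAreaLaw
import Literature.Probability.LatticeModels.ProductMeasureTools
import HarnessLib

/-!
# Non-vanishing of the plaquette expectation at strong coupling (uniformly in the volume)

Support file for the discharge of `osterwalder_seiler_areaLaw` (`LatticeGauge`, S14): the
string tension of an infinite-volume limit state is only defined when its Wilson loop
expectations do not vanish (`HasStaticPotential`); by reflection positivity the non-vanishing
of all rectangular loops reduces to that of a single one, and this file supplies the seed:
for `G = SU(N)`, `N ≥ 2` (`IsSpecialUnitaryModel ρ`), `d ≥ 2`, there are `β₂ > 0` and `c > 0`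
with `⟨W_{1×1}⟩_{Λ_{L+1}, β} ≥ c β` for all `0 < β ≤ β₂` and all `L ≥ 2`
(`wilsonExpectation_plaquette_ge`), hence `W_μ(1,1) ≥ c β > 0` for every
`μ ∈ infiniteVolumeLimitPoints ρ β` (`exists_rectExpectation_one_one_ge`).

The proof is the first-order strong-coupling expansion of the plaquette expectation
(Osterwalder–Seiler 1978 §3; Montvay–Münster (3.392)–(3.400): the leading term of `W(C)` is the
minimal surface term, here a single plaquette), made quantitative inside the polymer expansion
`PlaqSystem.expect_eq_sum` of the torus plaquette system (`StrongCouplingTorusSystem`):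

* the empty polymer and all singletons `{q}`, `q ≠ p`, contribute `0` (Haar mean zero; a centre
  twist of one bond of `p` not belonging to `q`, `TorusAreaLaw.integral_zdWilsonLoop_mul_eq_zero_of_twist`);
* the singleton `{p}` contributes `N⁻¹ m(β) · Z_{Λ∖N[p]}/Z_Λ` with
  `m(β) = ∫_G Re tr ρ(g) (e^{-β(N - Re tr ρ(g))} - 1) dg ≥ β e^{-2βN} ∫_G (Re tr ρ)² dg > 0`
  (`tiltedMoment_ge`, `charVariance_pos`), and `Z_{Λ∖E}/Z_Λ ≥ 1` for `β ≥ 0` because the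
  plaquette costs are non-negative (`exists_ratio_eq_ofReal`);
* the polymers with `≥ 2` plaquettes contribute `O(β²)` uniformly in the volume, by the
  counting of `LatticeGaugeTorusAreaLaw` (`norm_remainder_le`);
* assembled in `re_expect_obsF_ge` and transported to the torus Wilson expectation
  (`wilsonExpectation_toTorusObservable_eq_re_expect`) and to limit points
  (`le_rectExpectation_of_eventually`).

References: K. Osterwalder, E. Seiler, Ann. Phys. 110 (1978) 440, §3, §5; I. Montvay,
G. Münster, *Quantum Fields on a Lattice* (1994), §3.4–3.5; E. Seiler, LNP 159 (1982) Ch. 2–3.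
All statements here are proved. [folklore]
-/

noncomputable section

open MeasureTheory Filter Topology Finset
open Literature.MathematicalPhysics.QuantumLattice

namespace Literature.MathematicalPhysics.QuantumFieldTheory

open AreaLaw TorusAreaLaw

namespace PlaquetteLowerBound

variable {d N : ℕ} {G : Type*}

/-! ### Group integrals: the first moment of the tilted character -/

section GroupIntegrals

variable [Group G] [TopologicalSpace G] [IsTopologicalGroup G] [CompactSpace G] [MeasurableSpace G]
  [BorelSpace G] (ρ : G →* Matrix (Fin N) (Fin N) ℂ)

/-- The real character `x(g) = Re tr ρ(g)`. [folklore] -/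
def reTr (g : G) : ℝ := (ρ g).trace.re

/-- The variance `V₀ = ∫_G (Re tr ρ)² dg` of the real character. [folklore] -/
def charVariance : ℝ := ∫ g, reTr ρ g ^ 2 ∂haarProbability G

/-- The first moment of the tilted character,
`m(β) = ∫_G Re tr ρ(g) (exp(-β (N - Re tr ρ(g))) - 1) dg`. [folklore] -/
def tiltedMoment (β : ℝ) : ℝ :=
  ∫ g, reTr ρ g * (Real.exp (-(β * ((N : ℝ) - reTr ρ g))) - 1) ∂haarProbability G

omit [IsTopologicalGroup G] [CompactSpace G] [MeasurableSpace G] [BorelSpace G] in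
/-- The real character is continuous. [folklore] -/
theorem continuous_reTr (hρ : Continuous ρ) : Continuous (reTr ρ) := continuous_trace_re ρ hρ

omit [TopologicalSpace G] [IsTopologicalGroup G] [CompactSpace G] [MeasurableSpace G] [BorelSpace G] in
/-- `|Re tr ρ(g)| ≤ N` for unitary `ρ`. [folklore] -/
theorem abs_reTr_le (hρu : ∀ g, ρ g ∈ Matrix.unitaryGroup (Fin N) ℂ) (g : G) : |reTr ρ g| ≤ N :=
  abs_re_trace_le_of_mem_unitaryGroup (hρu g)

/-- **Haar mean zero of the character of `SU(N)`, `N ≥ 2`** (centre twist: `tr ρ(zg) = ζ tr ρ(g)`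
with `ζ ≠ 1`). [folklore] -/
theorem integral_reTr_eq_zero (hρ : IsSpecialUnitaryModel ρ) (hN : 2 ≤ N) :
    ∫ g, reTr ρ g ∂haarProbability G = 0 := by
  obtain ⟨z, ζ, hζ, hz1, -⟩ := IsSpecialUnitaryModel.exists_central ρ hρ hN
  have hc : Continuous fun g : G => (ρ g).trace := hρ.1.matrix_trace
  have hint : Integrable (fun g : G => (ρ g).trace) (haarProbability G) :=
    hc.integrable_of_hasCompactSupport (HasCompactSupport.of_compactSpace _)
  set J : ℂ := ∫ g, (ρ g).trace ∂haarProbability G with hJ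
  have h1 : J = ζ * J := by
    calc J = ∫ g, (ρ (z * g)).trace ∂haarProbability G :=
          (integral_mul_left_eq_self (μ := haarProbability G) (fun g => (ρ g).trace) z).symm
      _ = ∫ g, ζ * (ρ g).trace ∂haarProbability G := by
          refine integral_congr_ae (ae_of_all _ fun g => ?_)
          simp only [map_mul, hz1, smul_mul_assoc, one_mul, Matrix.trace_smul, smul_eq_mul]
      _ = ζ * J := integral_const_mul _ _
  have hJ0 : J = 0 := by
    have h2 : (1 - ζ) * J = 0 := by rw [sub_mul, one_mul, ← h1, sub_self]
    rcases mul_eq_zero.mp h2 with h | h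
    · exact absurd (sub_eq_zero.mp h).symm hζ
    · exact h
  have := integral_re hint
  simp only [RCLike.re_to_complex] at this
  unfold reTr
  rw [this, ← hJ, hJ0, Complex.zero_re]

/-- **The elementary inequality** behind the lower bound: for `|x| ≤ N` and `β ≥ 0`,
`x (e^{-β(N-x)} - 1) ≥ β e^{-2βN} x² + (e^{-βN} - 1) x`. [folklore] -/
theorem mul_expm1_ge {x β Nr : ℝ} (hβ : 0 ≤ β) (hx : |x| ≤ Nr) :
    β * Real.exp (-(2 * β * Nr)) * x ^ 2 + (Real.exp (-(β * Nr)) - 1) * x ≤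
      x * (Real.exp (-(β * (Nr - x))) - 1) := by
  rw [abs_le] at hx
  have hN : 0 ≤ Nr := by linarith
  -- `x (e^{-β(N-x)} - 1) = e^{-βN} x (e^{βx} - 1) + (e^{-βN} - 1) x`
  have hsplit : x * (Real.exp (-(β * (Nr - x))) - 1) =
      Real.exp (-(β * Nr)) * (x * (Real.exp (β * x) - 1)) + (Real.exp (-(β * Nr)) - 1) * x := by
    rw [show -(β * (Nr - x)) = -(β * Nr) + β * x by ring, Real.exp_add]; ring
  rw [hsplit, add_le_add_iff_right]
  -- `x (e^{βx} - 1) ≥ β x² e^{-βN}`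
  have hkey : β * x ^ 2 * Real.exp (-(β * Nr)) ≤ x * (Real.exp (β * x) - 1) := by
    rcases le_or_gt 0 x with hx0 | hx0
    · -- `x ≥ 0`: `e^{βx} - 1 ≥ βx ≥ βx e^{-βN}`
      have h1 : β * x ≤ Real.exp (β * x) - 1 := by linarith [Real.add_one_le_exp (β * x)]
      have h2 : Real.exp (-(β * Nr)) ≤ 1 := by
        rw [Real.exp_le_one_iff]; nlinarith
      calc β * x ^ 2 * Real.exp (-(β * Nr)) ≤ β * x ^ 2 * 1 := by
            gcongr
        _ = x * (β * x) := by ring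
        _ ≤ x * (Real.exp (β * x) - 1) := mul_le_mul_of_nonneg_left h1 hx0
    · -- `x < 0`: with `y = -βx ≥ 0`, `1 - e^{-y} ≥ y e^{-y} ≥ y e^{-βN}`
      have hy : 0 ≤ -(β * x) := by nlinarith
      have h1 : (-(β * x)) * Real.exp (β * x) ≤ 1 - Real.exp (β * x) := by
        -- `e^{-y}(1 + y) ≤ 1`
        have := Real.add_one_le_exp (-(β * x))
        have hpos := Real.exp_pos (β * x)
        have hprod : Real.exp (β * x) * Real.exp (-(β * x)) = 1 := by
          rw [← Real.exp_add, add_neg_cancel, Real.exp_zero]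
        nlinarith
      have h2 : Real.exp (-(β * Nr)) ≤ Real.exp (β * x) := Real.exp_le_exp.2 (by nlinarith)
      -- multiply by `-x > 0`
      have h3 : (-(β * x)) * Real.exp (-(β * Nr)) ≤ 1 - Real.exp (β * x) :=
        (mul_le_mul_of_nonneg_left h2 hy).trans h1
      have h4 : (-x) * ((-(β * x)) * Real.exp (-(β * Nr))) ≤ (-x) * (1 - Real.exp (β * x)) :=
        mul_le_mul_of_nonneg_left h3 (by linarith)
      calc β * x ^ 2 * Real.exp (-(β * Nr)) = (-x) * ((-(β * x)) * Real.exp (-(β * Nr))) := by ring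
        _ ≤ (-x) * (1 - Real.exp (β * x)) := h4
        _ = x * (Real.exp (β * x) - 1) := by ring
  calc β * Real.exp (-(2 * β * Nr)) * x ^ 2
      = Real.exp (-(β * Nr)) * (β * x ^ 2 * Real.exp (-(β * Nr))) := by
        rw [show -(2 * β * Nr) = -(β * Nr) + -(β * Nr) by ring, Real.exp_add]; ring
    _ ≤ Real.exp (-(β * Nr)) * (x * (Real.exp (β * x) - 1)) :=
        mul_le_mul_of_nonneg_left hkey (Real.exp_pos _).le

/-- **Lower bound for the tilted moment**: `m(β) ≥ β e^{-2βN} V₀` for `β ≥ 0` (and `G = SU(N)`,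
`N ≥ 2`, so that the first moment of the character vanishes). [folklore] -/
theorem tiltedMoment_ge (hρ : IsSpecialUnitaryModel ρ) (hN : 2 ≤ N) {β : ℝ} (hβ : 0 ≤ β) :
    β * Real.exp (-(2 * β * N)) * charVariance ρ ≤ tiltedMoment ρ β := by
  have hu := IsSpecialUnitaryModel.mem_unitaryGroup ρ hρ
  have hc := continuous_reTr ρ hρ.1
  have hint : ∀ {ψ : G → ℝ}, Continuous ψ → Integrable ψ (haarProbability G) := fun hψ =>
    hψ.integrable_of_hasCompactSupport (HasCompactSupport.of_compactSpace _)
  have i1 : Integrable (fun g => β * Real.exp (-(2 * β * N)) * reTr ρ g ^ 2) (haarProbability G) :=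
    hint (continuous_const.mul (hc.pow 2))
  have i2 : Integrable (fun g => (Real.exp (-(β * N)) - 1) * reTr ρ g) (haarProbability G) :=
    hint (continuous_const.mul hc)
  have i3 : Integrable (fun g => reTr ρ g * (Real.exp (-(β * ((N : ℝ) - reTr ρ g))) - 1))
      (haarProbability G) :=
    hint (hc.mul ((Real.continuous_exp.comp ((continuous_const.sub hc).const_mul β).neg).sub
      continuous_const))
  calc β * Real.exp (-(2 * β * N)) * charVariance ρ
      = (∫ g, β * Real.exp (-(2 * β * N)) * reTr ρ g ^ 2 ∂haarProbability G) +
          ∫ g, (Real.exp (-(β * N)) - 1) * reTr ρ g ∂haarProbability G := by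
        rw [integral_const_mul, integral_const_mul, integral_reTr_eq_zero ρ hρ hN, mul_zero, add_zero,
          charVariance]
    _ = ∫ g, β * Real.exp (-(2 * β * N)) * reTr ρ g ^ 2 + (Real.exp (-(β * N)) - 1) * reTr ρ g
          ∂haarProbability G := (integral_add i1 i2).symm
    _ ≤ tiltedMoment ρ β := integral_mono (i1.add i2) i3 fun g => mul_expm1_ge hβ (abs_reTr_le ρ hu g)

/-- **The character has positive variance**: `V₀ = ∫ (Re tr ρ)² > 0` (`Re tr ρ(1) = N ≥ 1` and Haar
measure charges open sets). [folklore] -/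
theorem charVariance_pos (hρ : Continuous ρ) (hN : 1 ≤ N) : 0 < charVariance ρ := by
  have hc := continuous_reTr ρ hρ
  have hc2 : Continuous fun g => reTr ρ g ^ 2 := hc.pow 2
  unfold charVariance
  rw [integral_pos_iff_support_of_nonneg (fun g => sq_nonneg _)
    (hc2.integrable_of_hasCompactSupport (HasCompactSupport.of_compactSpace _))]
  have h1 : reTr ρ 1 = N := by simp [reTr, Matrix.trace_one]
  have hopen : IsOpen (Function.support fun g => reTr ρ g ^ 2) :=
    isOpen_ne.preimage hc2
  have hmem : (1 : G) ∈ Function.support fun g => reTr ρ g ^ 2 := by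
    rw [Function.mem_support, h1]
    have : (0 : ℝ) < N := by exact_mod_cast hN
    positivity
  exact hopen.measure_pos (haarProbability G) ⟨1, hmem⟩

end GroupIntegrals

/-! ### The plaquette as a `1 × 1` Wilson loop; its Haar distribution -/

section Plaquette

variable [Group G] (ρ : G →* Matrix (Fin N) (Fin N) ℂ)

/-- A one-step line is a single link variable. [folklore] -/
theorem line_one (U : ZdGaugeConfig d G) (k : Fin d) (y : Literature.Probability.LatticeModels.Site d) :
    U.line k 1 y = U (y, k) := by
  simp [ZdGaugeConfig.line]

/-- The `1 × 1` rectangle is the plaquette. [folklore] -/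
theorem rectangle_one_one (U : ZdGaugeConfig d G) (x : Literature.Probability.LatticeModels.Site d)
    (i j : Fin d) : U.rectangle x i j 1 1 = U.plaquette x i j := by
  simp only [ZdGaugeConfig.rectangle, ZdGaugeConfig.plaquette, line_one, Nat.cast_one]

/-- The `1 × 1` Wilson loop is the normalised plaquette character. [folklore] -/
theorem zdWilsonLoop_one_one (U : ZdGaugeConfig d G) (x : Literature.Probability.LatticeModels.Site d)
    (i j : Fin d) : zdWilsonLoop ρ x i j 1 1 U = (N : ℝ)⁻¹ * (ρ (U.plaquette x i j)).trace.re := by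
  rw [zdWilsonLoop, rectangle_one_one]

variable [TopologicalSpace G] [IsTopologicalGroup G] [CompactSpace G] [MeasurableSpace G] [BorelSpace G]

/-- **The plaquette variable is Haar distributed** under the product Haar measure: for a
continuous `Φ : G → ℝ` and `i ≠ j`, `∫ Φ(U_p) dg_∞ = ∫_G Φ dg` (resample one bond of `p`,
`StatMech.integral_infinitePi_eq_integral_update`, and use Haar invariance over that bond,
`integral_update_plaquette`). [folklore] -/
theorem integral_comp_plaquette_eq [SecondCountableTopology G] {Φ : G → ℝ} (hΦ : Continuous Φ)
    (x : Literature.Probability.LatticeModels.Site d) {i j : Fin d} (hij : i ≠ j) :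
    ∫ U, Φ (ZdGaugeConfig.plaquette U x i j) ∂zdHaar d G = ∫ g, Φ g ∂haarProbability G := by
  classical
  have hcont : Continuous fun U : ZdGaugeConfig d G => Φ (U.plaquette x i j) :=
    hΦ.comp (continuous_plaquette x i j)
  have hint : Integrable (fun U : ZdGaugeConfig d G => Φ (U.plaquette x i j)) (zdHaar d G) :=
    integrable_zdHaar_of_continuous hcont
  rw [zdHaar, Literature.Probability.LatticeModels.integral_infinitePi_eq_integral_update
    (fun _ : ZdEdge d => haarProbability G) ((x, i) : ZdEdge d) hint]
  have hupd : ∀ U : ZdGaugeConfig d G,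
      ∫ g, Φ (ZdGaugeConfig.plaquette (Function.update U (x, i) g) x i j) ∂haarProbability G =
        ∫ g, Φ g ∂haarProbability G := fun U =>
    (integral_update_plaquette hΦ x hij U (e := (x, i)) (Or.inl rfl)).2
  simp_rw [hupd]
  rw [integral_const, probReal_univ, one_smul]

end Plaquette

/-! ### The torus plaquette system at real non-negative coupling -/

section TorusSystem

variable [Group G] [TopologicalSpace G] [IsTopologicalGroup G] [CompactSpace G] [MeasurableSpace G]
  [BorelSpace G] (ρ : G →* Matrix (Fin N) (Fin N) ℂ) {L : ℕ} [NeZero L]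

/-- For real `β` the partition functions of the torus system are real:
`partZ W β = ∫ exp(-β ∑_{p ∈ W} s_p) dν`. [folklore] -/
theorem partZ_ofReal (β : ℝ) (W : Finset (TPlaq d L)) :
    (torusSystem ρ L).partZ W (β : ℂ) =
      ((∫ U, Real.exp (-(β * ∑ p ∈ W, torusCost ρ L p U)) ∂zdHaar d G : ℝ) : ℂ) := by
  rw [PlaqSystem.partZ_eq]
  simp_rw [PlaqSystem.prod_one_add_weight]
  rw [← integral_complex_ofReal]
  refine integral_congr_ae (ae_of_all _ fun U => ?_)
  simp only [torusSystem_cost]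
  rw [Complex.ofReal_exp]
  push_cast
  rfl

omit [TopologicalSpace G] [IsTopologicalGroup G] [CompactSpace G] [MeasurableSpace G] [BorelSpace G]
  [NeZero L] in
/-- The torus plaquette costs are non-negative for unitary `ρ` (`Re tr ρ(U_p) ≤ N`). [folklore] -/
theorem torusCost_nonneg (hρu : ∀ g, ρ g ∈ Matrix.unitaryGroup (Fin N) ℂ) (L : ℕ) (p : TPlaq d L)
    (U : ZdGaugeConfig d G) : 0 ≤ torusCost ρ L p U := by
  unfold torusCost
  have h := abs_re_trace_le_of_mem_unitaryGroup (hρu (plaquetteHolonomy (torusSigma L U) p.1 p.2.1 p.2.2))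
  rw [abs_le] at h
  linarith

omit [IsTopologicalGroup G] [MeasurableSpace G] [BorelSpace G] [NeZero L] in
/-- The real partition function integrand is bounded and bounded below. [folklore] -/
theorem exp_neg_sum_torusCost_le (hρ : Continuous ρ) (β : ℝ) (W : Finset (TPlaq d L))
    (U : ZdGaugeConfig d G) :
    Real.exp (-(|β| * costBound ρ * #W)) ≤ Real.exp (-(β * ∑ p ∈ W, torusCost ρ L p U)) ∧
      Real.exp (-(β * ∑ p ∈ W, torusCost ρ L p U)) ≤ Real.exp (|β| * costBound ρ * #W) := by
  have hs : |∑ p ∈ W, torusCost ρ L p U| ≤ costBound ρ * #W := by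
    calc |∑ p ∈ W, torusCost ρ L p U| ≤ ∑ p ∈ W, |torusCost ρ L p U| := abs_sum_le_sum_abs _ _
      _ ≤ ∑ _p ∈ W, costBound ρ := sum_le_sum fun p _ => abs_torusCost_le ρ hρ L p U
      _ = costBound ρ * #W := by rw [sum_const, nsmul_eq_mul, mul_comm]
  have hb : |β * ∑ p ∈ W, torusCost ρ L p U| ≤ |β| * costBound ρ * #W := by
    rw [abs_mul, mul_assoc]; exact mul_le_mul_of_nonneg_left hs (abs_nonneg _)
  rw [abs_le] at hb
  exact ⟨Real.exp_le_exp.2 (by linarith), Real.exp_le_exp.2 (by linarith)⟩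

omit [NeZero L] in
/-- The real partition functions are positive. [folklore] -/
theorem partZ_real_pos [SecondCountableTopology G] (hρ : Continuous ρ) (β : ℝ) (W : Finset (TPlaq d L)) :
    0 < ∫ U, Real.exp (-(β * ∑ p ∈ W, torusCost ρ L p U)) ∂zdHaar d G := by
  have hm : Measurable fun U : ZdGaugeConfig d G => Real.exp (-(β * ∑ p ∈ W, torusCost ρ L p U)) :=
    ((Finset.measurable_sum _ fun p _ => measurable_torusCost ρ hρ L p).const_mul β).neg.exp
  have hint : Integrable (fun U : ZdGaugeConfig d G => Real.exp (-(β * ∑ p ∈ W, torusCost ρ L p U)))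
      (zdHaar d G) :=
    Integrable.of_bound hm.aestronglyMeasurable (Real.exp (|β| * costBound ρ * #W))
      (ae_of_all _ fun U => by
        rw [Real.norm_eq_abs, abs_of_pos (Real.exp_pos _)]
        exact (exp_neg_sum_torusCost_le ρ hρ β W U).2)
  calc (0 : ℝ) < Real.exp (-(|β| * costBound ρ * #W)) := Real.exp_pos _
    _ = ∫ _U, Real.exp (-(|β| * costBound ρ * #W)) ∂zdHaar d G := by
        rw [integral_const, probReal_univ, one_smul]
    _ ≤ _ := integral_mono (integrable_const _) hint fun U => (exp_neg_sum_torusCost_le ρ hρ β W U).1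

omit [NeZero L] in
/-- **Removing plaquettes increases the partition function** (`β ≥ 0`, non-negative costs):
`Z_V ≤ Z_{V ∖ E}`. [folklore] -/
theorem partZ_real_le_sdiff [SecondCountableTopology G] (hρ : Continuous ρ)
    (hρu : ∀ g, ρ g ∈ Matrix.unitaryGroup (Fin N) ℂ) {β : ℝ} (hβ : 0 ≤ β) (V E : Finset (TPlaq d L)) :
    ∫ U, Real.exp (-(β * ∑ p ∈ V, torusCost ρ L p U)) ∂zdHaar d G ≤
      ∫ U, Real.exp (-(β * ∑ p ∈ V \ E, torusCost ρ L p U)) ∂zdHaar d G := by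
  have hm : ∀ W : Finset (TPlaq d L),
      Measurable fun U : ZdGaugeConfig d G => Real.exp (-(β * ∑ p ∈ W, torusCost ρ L p U)) := fun W =>
    ((Finset.measurable_sum _ fun p _ => measurable_torusCost ρ hρ L p).const_mul β).neg.exp
  have hint : ∀ W : Finset (TPlaq d L),
      Integrable (fun U : ZdGaugeConfig d G => Real.exp (-(β * ∑ p ∈ W, torusCost ρ L p U))) (zdHaar d G) :=
    fun W => Integrable.of_bound (hm W).aestronglyMeasurable (Real.exp (|β| * costBound ρ * #W))
      (ae_of_all _ fun U => by
        rw [Real.norm_eq_abs, abs_of_pos (Real.exp_pos _)]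
        exact (exp_neg_sum_torusCost_le ρ hρ β W U).2)
  classical
  refine integral_mono (hint V) (hint (V \ E)) fun U => Real.exp_le_exp.2 ?_
  rw [← Finset.sum_inter_add_sum_sdiff V E]
  have : 0 ≤ ∑ p ∈ V ∩ E, torusCost ρ L p U := sum_nonneg fun p _ => torusCost_nonneg ρ hρu L p U
  nlinarith

/-- **The ratios of partition functions are real and at least `1`** for `0 ≤ β` and unitary `ρ`:
`Z_{V∖E}(β)/Z_V(β) ≥ 1`. [folklore] -/
theorem exists_ratio_eq_ofReal [SecondCountableTopology G] (hρ : Continuous ρ)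
    (hρu : ∀ g, ρ g ∈ Matrix.unitaryGroup (Fin N) ℂ) {β : ℝ} (hβ : 0 ≤ β) (V E : Finset (TPlaq d L)) :
    ∃ r : ℝ, 1 ≤ r ∧ (torusSystem ρ L).ratio V E (β : ℂ) = (r : ℂ) := by
  set a := ∫ U, Real.exp (-(β * ∑ p ∈ V \ E, torusCost ρ L p U)) ∂zdHaar d G with ha
  set b := ∫ U, Real.exp (-(β * ∑ p ∈ V, torusCost ρ L p U)) ∂zdHaar d G with hb
  have hbpos : 0 < b := partZ_real_pos ρ hρ β V
  have hab : b ≤ a := partZ_real_le_sdiff ρ hρ hρu hβ V E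
  refine ⟨a / b, (one_le_div hbpos).2 hab, ?_⟩
  rw [PlaqSystem.ratio, partZ_ofReal, partZ_ofReal, ← ha, ← hb, ← Complex.ofReal_div]

end TorusSystem

/-! ### The origin plaquette and its torus label -/

section Origin

variable [NeZero d]

/-- The plaquette at the origin in the `(0, 1)` plane, as a plaquette label of `ℤ^d`. [folklore] -/
def p₀ : Plaq d := ((0 : Literature.Probability.LatticeModels.Site d), (0 : Fin d), (1 : Fin d))

omit [NeZero d] in
/-- The coordinates of `eₖ` are `0` or `1`. [folklore] -/
theorem single_coord (k m : Fin d) :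
    0 ≤ (Pi.single k (1 : ℤ) : Literature.Probability.LatticeModels.Site d) m ∧
      (Pi.single k (1 : ℤ) : Literature.Probability.LatticeModels.Site d) m ≤ 1 := by
  by_cases h : m = k
  · subst h; simp
  · simp [Pi.single_eq_of_ne h]

variable {L : ℕ} [NeZero L]

/-- For `L ≥ 2` the bonds of the origin plaquette are their own reductions. [folklore] -/
theorem torusRed_eq_self_of_mem_bonds_p₀ (hL : 2 ≤ L) {e : ZdEdge d} (he : e ∈ (p₀ : Plaq d).bonds) :
    torusRed L e = e := by
  refine torusRed_eq_self fun m => ?_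
  simp only [p₀, Plaq.bonds, Finset.mem_insert, Finset.mem_singleton, zero_add] at he
  rcases he with rfl | rfl | rfl | rfl
  · simp only [Pi.zero_apply]; constructor <;> omega
  · have := single_coord (d := d) 0 m; simp only; constructor <;> omega
  · have := single_coord (d := d) 1 m; simp only; constructor <;> omega
  · simp only [Pi.zero_apply]; constructor <;> omega

variable [Group G] (ρ : G →* Matrix (Fin N) (Fin N) ℂ)

/-- The cost of the origin plaquette does not see the reduction (`L ≥ 2`). [folklore] -/
theorem plaqCost_p₀_comp_torusRed (hL : 2 ≤ L) (U : ZdGaugeConfig d G) :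
    plaqCost ρ (p₀ : Plaq d) (U ∘ torusRed L) = plaqCost ρ (p₀ : Plaq d) U :=
  dependsOn_plaqCost (ρ := ρ) p₀ fun e he => by
    show U (torusRed L e) = U e
    rw [torusRed_eq_self_of_mem_bonds_p₀ hL (Finset.mem_coe.1 he)]

/-- The cost of the origin plaquette in terms of the real character. [folklore] -/
theorem plaqCost_p₀ (U : ZdGaugeConfig d G) :
    plaqCost ρ (p₀ : Plaq d) U = (N : ℝ) - reTr ρ (U.plaquette 0 0 1) := rfl

omit [NeZero L] [Group G] in
/-- The torus label of the origin plaquette. [folklore] -/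
theorem torusProj_p₀ : torusProj L (p₀ : Plaq d) = ((0 : Site d L), (0 : Fin d), (1 : Fin d)) := by
  simp only [torusProj, p₀, Prod.mk.injEq, and_true]
  funext i
  simp [Literature.Probability.LatticeModels.Torus.proj]

end Origin

/-! ### The terms of the expansion of the plaquette expectation -/

section Terms

variable [NeZero d] [Group G] [TopologicalSpace G] [IsTopologicalGroup G] [CompactSpace G]
  [MeasurableSpace G] [BorelSpace G] (ρ : G →* Matrix (Fin N) (Fin N) ℂ) {L : ℕ} [NeZero L]

/-- The plaquette observable of the expansion (the `1 × 1` Wilson loop, complexified). [folklore] -/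
def obsF (U : ZdGaugeConfig d G) : ℂ := ((zdWilsonLoop ρ 0 0 1 1 1 U : ℝ) : ℂ)

/-- **The self term**: `aPol W {p} β = N⁻¹ m(β)` (the plaquette variable is Haar distributed).
[folklore] -/
theorem aPol_singleton_self [SecondCountableTopology G] (hρ : Continuous ρ) (h01 : (0 : Fin d) ≠ 1)
    (hL : 2 ≤ L) (β : ℝ) :
    (torusSystem ρ L).aPol (obsF ρ) {torusProj L (p₀ : Plaq d)} (β : ℂ) =
      ((((N : ℝ)⁻¹ * tiltedMoment ρ β : ℝ)) : ℂ) := by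
  set Φ : G → ℝ := fun g => reTr ρ g * (Real.exp (-(β * ((N : ℝ) - reTr ρ g))) - 1) with hΦ
  have hΦc : Continuous Φ := by
    have hc := continuous_reTr ρ hρ
    exact hc.mul ((Real.continuous_exp.comp ((continuous_const.sub hc).const_mul β).neg).sub
      continuous_const)
  have hint : ∀ U : ZdGaugeConfig d G, obsF ρ U * (torusSystem ρ L).weightProd (β : ℂ) {torusProj L (p₀ : Plaq d)} U =
      (((N : ℝ)⁻¹ * Φ (U.plaquette 0 0 1) : ℝ) : ℂ) := by
    intro U
    rw [PlaqSystem.weightProd, Finset.prod_singleton, weight_torusProj, plaqWeight,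
      plaqCost_p₀_comp_torusRed ρ hL, plaqCost_p₀, obsF, zdWilsonLoop_one_one]
    simp only [hΦ, reTr]
    push_cast
    ring
  unfold PlaqSystem.aPol
  simp_rw [hint]
  rw [integral_complex_ofReal, integral_const_mul, integral_comp_plaquette_eq hΦc 0 h01]
  rfl

omit [TopologicalSpace G] [IsTopologicalGroup G] [CompactSpace G] [MeasurableSpace G] [BorelSpace G] in
/-- **Which torus plaquettes contain both `z`-carrying bonds of the origin plaquette**: only the
origin plaquette itself (`L ≥ 2`). [folklore] -/
theorem eq_torusProj_p₀ [Fact (1 < L)] (h01 : (0 : Fin d) ≠ 1) {q : TPlaq d L} (hq : q.2.1 < q.2.2)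
    (h1 : ((0 : Literature.Probability.LatticeModels.Site d), (0 : Fin d)) ∈ (torusSystem (G := G) ρ L).bonds q)
    (h2 : (((0 : Literature.Probability.LatticeModels.Site d) + Pi.single 0 1), (1 : Fin d)) ∈
      (torusSystem (G := G) ρ L).bonds q) :
    q = torusProj L (p₀ : Plaq d) := by
  rw [torusProj_p₀]
  obtain ⟨y, k, l⟩ := q
  simp only at hq
  have hl0 : l ≠ 0 := fun h => by rw [h] at hq; exact (Fin.not_lt_zero _ hq).elim
  rw [torusSystem_bonds, Finset.mem_image] at h1 h2
  obtain ⟨b, hb, hb0⟩ := h1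
  obtain ⟨b', hb', hb1⟩ := h2
  -- translate the sectioned bonds back to torus bonds
  have hproj0 : Literature.Probability.LatticeModels.Torus.proj L
      (0 : Literature.Probability.LatticeModels.Site d) = (0 : Site d L) := by
    funext i; simp [Literature.Probability.LatticeModels.Torus.proj]
  have hlift0 : ∀ z : Site d L, torusSiteLift z = 0 → z = 0 := fun z hz => by
    rw [← torusProj_torusSiteLift z, hz]; exact hproj0
  have hlift1 : ∀ z : Site d L, torusSiteLift z = (0 : Literature.Probability.LatticeModels.Site d) + Pi.single 0 1 →
      z = (0 : Site d L).shift 0 := fun z hz => by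
    rw [← torusProj_torusSiteLift z, hz, zero_add, Site.shift, zero_add]
    exact torusProj_site_single L 0
  have hb0' : b = ((0 : Site d L), (0 : Fin d)) := by
    rcases b with ⟨z, m⟩
    simp only [torusSect, Prod.mk.injEq] at hb0
    exact Prod.ext (hlift0 z hb0.1) hb0.2
  have hb1' : b' = ((0 : Site d L).shift 0, (1 : Fin d)) := by
    rcases b' with ⟨z, m⟩
    simp only [torusSect, Prod.mk.injEq] at hb1
    exact Prod.ext (hlift1 z hb1.1) hb1.2
  subst hb0' hb1'
  have h1L : 1 < L := Fact.out
  have hone : (1 : ZMod L) ≠ 0 := by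
    haveI : Nontrivial (ZMod L) := ZMod.nontrivial_iff.2 (by omega)
    exact one_ne_zero
  have hsingle : ((0 : Site d L).shift 0) ≠ 0 := fun h => by
    have := congrFun h 0
    simp only [Site.shift, zero_add, Pi.single_eq_same, Pi.zero_apply] at this
    exact hone this
  simp only [TPlaq.tbonds, Finset.mem_insert, Finset.mem_singleton, Prod.mk.injEq] at hb hb'
  -- from the first membership: `k = 0` and (`y = 0` or `y.shift l = 0`)
  have hk : k = 0 := by
    rcases hb with ⟨-, h⟩ | ⟨-, h⟩ | ⟨-, h⟩ | ⟨-, h⟩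
    · exact h.symm
    · exact absurd h.symm hl0
    · exact h.symm
    · exact absurd h.symm hl0
  subst hk
  -- from the second membership: `l = 1` and `y = 0`
  rcases hb' with ⟨-, h⟩ | ⟨hy, hl⟩ | ⟨-, h⟩ | ⟨hy, hl⟩
  · exact absurd h.symm h01
  · subst hl
    have hy0 : y = 0 := by
      have : y.shift 0 = (0 : Site d L).shift 0 := hy.symm
      simpa [Site.shift] using this
    subst hy0
    rfl
  · exact absurd h.symm h01
  · subst hl
    exfalso
    rcases hb with ⟨hy', -⟩ | ⟨-, h⟩ | ⟨hy', -⟩ | ⟨-, h⟩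
    · exact hsingle (hy.trans hy'.symm)
    · exact hl0 h.symm
    · -- `y.shift 1 = 0` with `y = e₀`: coordinate `0` gives `1 = 0`
      rw [← hy] at hy'
      have := congrFun hy' 0
      simp only [Site.shift, zero_add, Pi.add_apply, Pi.zero_apply, Pi.single_eq_same,
        Pi.single_eq_of_ne h01, add_zero] at this
      exact hone this.symm
    · exact hl0 h.symm

/-! ### Single-bond centre twists of the origin plaquette -/

/-- The set consisting of one bond. [folklore] -/
def bondSet (e : ZdEdge d) : Set (ZdEdge d) := {e' | e' = e}

omit [NeZero d] in
/-- Membership in `bondSet`. [folklore] -/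
theorem mem_bondSet {e e' : ZdEdge d} : e' ∈ bondSet e ↔ e' = e := Iff.rfl

/-- Membership in `bondSet` is decidable. [folklore] -/
instance bondSet.decidablePred (e : ZdEdge d) : DecidablePred (· ∈ bondSet e) := fun e' =>
  decidable_of_iff (e' = e) Iff.rfl

omit [TopologicalSpace G] [IsTopologicalGroup G] [CompactSpace G] [MeasurableSpace G] [BorelSpace G]
  [NeZero L] in
/-- Twisting the bond `(0, 0)` multiplies the `1 × 1` loop by the twisting element. [folklore] -/
theorem rectangle_twist_bond00 (h01 : (0 : Fin d) ≠ 1) (z : G) (U : ZdGaugeConfig d G) :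
    (twist (bondSet ((0 : Literature.Probability.LatticeModels.Site d), (0 : Fin d))) z U).rectangle 0 0 1 1 1 =
      z * U.rectangle 0 0 1 1 1 := by
  have hne1 : ((0 : Literature.Probability.LatticeModels.Site d) + Pi.single 1 1) ≠ 0 := fun h => by
    have := congrFun h 1; simp at this
  rw [rectangle_one_one, rectangle_one_one]
  unfold ZdGaugeConfig.plaquette twist
  have h1 : ((0 : Literature.Probability.LatticeModels.Site d), (0 : Fin d)) ∈
      bondSet ((0 : Literature.Probability.LatticeModels.Site d), (0 : Fin d)) := rfl
  have h2 : (((0 : Literature.Probability.LatticeModels.Site d) + Pi.single 0 1), (1 : Fin d)) ∉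
      bondSet ((0 : Literature.Probability.LatticeModels.Site d), (0 : Fin d)) :=
    fun h => h01.symm (congrArg Prod.snd (mem_bondSet.1 h))
  have h3 : (((0 : Literature.Probability.LatticeModels.Site d) + Pi.single 1 1), (0 : Fin d)) ∉
      bondSet ((0 : Literature.Probability.LatticeModels.Site d), (0 : Fin d)) :=
    fun h => hne1 (congrArg Prod.fst (mem_bondSet.1 h))
  have h4 : ((0 : Literature.Probability.LatticeModels.Site d), (1 : Fin d)) ∉
      bondSet ((0 : Literature.Probability.LatticeModels.Site d), (0 : Fin d)) :=
    fun h => h01.symm (congrArg Prod.snd (mem_bondSet.1 h))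
  rw [if_pos h1, if_neg h2, if_neg h3, if_neg h4]
  simp only [mul_assoc]

omit [TopologicalSpace G] [IsTopologicalGroup G] [CompactSpace G] [MeasurableSpace G] [BorelSpace G]
  [NeZero L] in
/-- Twisting the bond `(e₀, 1)` multiplies the `1 × 1` loop by the (central) twisting element.
[folklore] -/
theorem rectangle_twist_bond01 (h01 : (0 : Fin d) ≠ 1) {z : G} (hz : ∀ g : G, g * z = z * g)
    (U : ZdGaugeConfig d G) :
    (twist (bondSet (((0 : Literature.Probability.LatticeModels.Site d) + Pi.single 0 1), (1 : Fin d))) z U).rectangle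
        0 0 1 1 1 = z * U.rectangle 0 0 1 1 1 := by
  have hne0 : ((0 : Literature.Probability.LatticeModels.Site d) + Pi.single 0 1) ≠ 0 := fun h => by
    have := congrFun h 0; simp at this
  rw [rectangle_one_one, rectangle_one_one]
  unfold ZdGaugeConfig.plaquette twist
  have h1 : ((0 : Literature.Probability.LatticeModels.Site d), (0 : Fin d)) ∉
      bondSet (((0 : Literature.Probability.LatticeModels.Site d) + Pi.single 0 1), (1 : Fin d)) :=
    fun h => h01 (congrArg Prod.snd (mem_bondSet.1 h))
  have h2 : (((0 : Literature.Probability.LatticeModels.Site d) + Pi.single 0 1), (1 : Fin d)) ∈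
      bondSet (((0 : Literature.Probability.LatticeModels.Site d) + Pi.single 0 1), (1 : Fin d)) := rfl
  have h3 : (((0 : Literature.Probability.LatticeModels.Site d) + Pi.single 1 1), (0 : Fin d)) ∉
      bondSet (((0 : Literature.Probability.LatticeModels.Site d) + Pi.single 0 1), (1 : Fin d)) :=
    fun h => h01 (congrArg Prod.snd (mem_bondSet.1 h))
  have h4 : ((0 : Literature.Probability.LatticeModels.Site d), (1 : Fin d)) ∉
      bondSet (((0 : Literature.Probability.LatticeModels.Site d) + Pi.single 0 1), (1 : Fin d)) :=
    fun h => hne0 (congrArg Prod.fst (mem_bondSet.1 h)).symm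
  rw [if_neg h1, if_pos h2, if_neg h3, if_neg h4]
  rw [← mul_assoc (U (0, 0)) z, hz]
  simp only [mul_assoc]

/-- **The plaquette has Haar mean zero**: `∫ W_{1×1} dg_∞ = 0` (`G = SU(N)`, `N ≥ 2`). [folklore] -/
theorem integral_zdWilsonLoop_one_one_eq_zero [SecondCountableTopology G] (hρ : IsSpecialUnitaryModel ρ)
    (hN : 2 ≤ N) (h01 : (0 : Fin d) ≠ 1) :
    ∫ U, zdWilsonLoop ρ 0 0 1 1 1 U ∂zdHaar d G = 0 := by
  have h := integral_zdWilsonLoop_mul_eq_zero_of_twist ρ hρ hN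
    (bondSet ((0 : Literature.Probability.LatticeModels.Site d), (0 : Fin d))) 0 0 1 1 1
    (fun z _ U => rectangle_twist_bond00 h01 z U) (fun _ => (1 : ℝ)) measurable_const (C := 1)
    (fun _ => by simp) (fun _ _ _ => rfl)
  simpa using h

/-- The real weight of a torus plaquette. [folklore] -/
def realWeight (β : ℝ) (q : TPlaq d L) (U : ZdGaugeConfig d G) : ℝ :=
  Real.exp (-(β * torusCost ρ L q U)) - 1

omit [NeZero d] [TopologicalSpace G] [IsTopologicalGroup G] [CompactSpace G] [MeasurableSpace G] [BorelSpace G] in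
/-- For real `β` the singleton weight product is the real weight. [folklore] -/
theorem weightProd_singleton (β : ℝ) (q : TPlaq d L) (U : ZdGaugeConfig d G) :
    (torusSystem ρ L).weightProd (β : ℂ) {q} U = ((realWeight ρ β q U : ℝ) : ℂ) := by
  rw [PlaqSystem.weightProd, Finset.prod_singleton, PlaqSystem.weight, torusSystem_cost, realWeight]
  push_cast
  rfl

omit [NeZero d] [TopologicalSpace G] [IsTopologicalGroup G] [CompactSpace G] [MeasurableSpace G] [BorelSpace G] in
/-- The real weight of `q` does not see a twist of bonds outside `q`. [folklore] -/
theorem realWeight_twist (β : ℝ) (q : TPlaq d L) (H : Set (ZdEdge d)) [DecidablePred (· ∈ H)]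
    (hH : ∀ e ∈ (torusSystem (G := G) ρ L).bonds q, e ∉ H) (z : G) (U : ZdGaugeConfig d G) :
    realWeight ρ β q (twist H z U) = realWeight ρ β q U := by
  unfold realWeight
  have : torusCost ρ L q (twist H z U) = torusCost ρ L q U :=
    (torusSystem (G := G) ρ L).dependsOn_cost q fun e he => twist_apply_of_not_mem (hH e (Finset.mem_coe.1 he))
  rw [this]

omit [NeZero d] [NeZero L] [IsTopologicalGroup G] [MeasurableSpace G] [BorelSpace G] in
/-- The real weights are bounded. [folklore] -/
theorem abs_realWeight_le (hρ : Continuous ρ) (β : ℝ) (q : TPlaq d L) (U : ZdGaugeConfig d G) :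
    |realWeight ρ β q U| ≤ Real.exp (|β| * costBound ρ) + 1 := by
  have h := abs_prod_weight_le ρ hρ β {q} U
  rw [Finset.prod_singleton, Finset.card_singleton, pow_one] at h
  exact h

omit [NeZero d] [NeZero L] [CompactSpace G] in
/-- The real weights are measurable. [folklore] -/
theorem measurable_realWeight (hρ : Continuous ρ) (β : ℝ) (q : TPlaq d L) :
    Measurable (realWeight (G := G) ρ β q) :=
  ((measurable_torusCost ρ hρ L q).const_mul β).neg.exp.sub measurable_const

/-- **The singletons other than the origin plaquette contribute nothing**: for a genuine torus
plaquette `q ≠ p`, `aPol W {q} β = 0` (centre twist of a bond of `p` not in `q`). [folklore] -/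
theorem aPol_singleton_eq_zero [Fact (1 < L)] (hρ : IsSpecialUnitaryModel ρ) (hN : 2 ≤ N)
    (h01 : (0 : Fin d) ≠ 1) (β : ℝ) {q : TPlaq d L} (hq : q.2.1 < q.2.2) (hne : q ≠ torusProj L (p₀ : Plaq d)) :
    (torusSystem ρ L).aPol (obsF ρ) {q} (β : ℂ) = 0 := by
  haveI := IsSpecialUnitaryModel.secondCountableTopology ρ hρ
  have key : ((0 : Literature.Probability.LatticeModels.Site d), (0 : Fin d)) ∉ (torusSystem (G := G) ρ L).bonds q ∨
      (((0 : Literature.Probability.LatticeModels.Site d) + Pi.single 0 1), (1 : Fin d)) ∉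
        (torusSystem (G := G) ρ L).bonds q := by
    by_contra h
    push Not at h
    exact hne (eq_torusProj_p₀ ρ h01 hq h.1 h.2)
  have hred : ∀ U, obsF ρ U * (torusSystem ρ L).weightProd (β : ℂ) {q} U =
      ((zdWilsonLoop ρ 0 0 1 1 1 U * realWeight ρ β q U : ℝ) : ℂ) := fun U => by
    rw [weightProd_singleton, obsF, Complex.ofReal_mul]
  unfold PlaqSystem.aPol
  simp_rw [hred]
  rw [integral_complex_ofReal, Complex.ofReal_eq_zero]
  rcases key with hk | hk
  · refine integral_zdWilsonLoop_mul_eq_zero_of_twist ρ hρ hN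
      (bondSet ((0 : Literature.Probability.LatticeModels.Site d), (0 : Fin d))) 0 0 1 1 1
      (fun z _ U => rectangle_twist_bond00 h01 z U) _ (measurable_realWeight ρ hρ.1 β q)
      (abs_realWeight_le ρ hρ.1 β q) fun z _ U => realWeight_twist ρ β q _ (fun e he hmem => ?_) z U
    rw [mem_bondSet] at hmem
    exact hk (hmem ▸ he)
  · refine integral_zdWilsonLoop_mul_eq_zero_of_twist ρ hρ hN
      (bondSet (((0 : Literature.Probability.LatticeModels.Site d) + Pi.single 0 1), (1 : Fin d))) 0 0 1 1 1
      (fun z hz U => rectangle_twist_bond01 h01 hz U) _ (measurable_realWeight ρ hρ.1 β q)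
      (abs_realWeight_le ρ hρ.1 β q) fun z _ U => realWeight_twist ρ β q _ (fun e he hmem => ?_) z U
    rw [mem_bondSet] at hmem
    exact hk (hmem ▸ he)

/-! ### The remainder: polymers with at least two plaquettes -/

/-- The index set of the polymer expansion of the plaquette expectation: seed-connected sets of
genuine torus plaquettes. [folklore] -/
def Tset (L : ℕ) [NeZero L] : Finset (Finset (TPlaq d L)) :=
  (torusGenuine d L).powerset.filter
    (Polymer.IsSeedConn (torusSystem (G := G) ρ L).Adj
      ((torusSystem (G := G) ρ L).Touches
        (loopEdges (0 : Literature.Probability.LatticeModels.Site d) 0 1 1 1)))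

/-- The terms of the polymer expansion of the plaquette expectation. [folklore] -/
def term (L : ℕ) [NeZero L] (β : ℝ) (Q₁ : Finset (TPlaq d L)) : ℂ :=
  (torusSystem ρ L).aPol (obsF ρ) Q₁ β *
    (torusSystem ρ L).ratio (torusGenuine d L)
      ((torusSystem ρ L).snbAll (loopEdges (0 : Literature.Probability.LatticeModels.Site d) 0 1 1 1) Q₁) β

/-- The remainder of the expansion: the terms with at least two plaquettes. [folklore] -/
def remainder (L : ℕ) [NeZero L] (β : ℝ) : ℂ :=
  ∑ Q₁ ∈ (Tset (d := d) (G := G) ρ L).filter (fun Q => 2 ≤ #Q), term ρ L β Q₁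

/-- **The polymers with at least two plaquettes contribute `O(β²)`**, uniformly in the volume:
for `0 ≤ β ≤ β₁`, `‖∑_{|Q| ≥ 2} aPol W Q β · R(V, N[Q])(β)‖ ≤ (2e^{1/2})^{4·2^d d²} (β/β₁)²`
(the counting of `LatticeGaugeTorusAreaLaw` with the area `R T` replaced by `2`). [folklore] -/
theorem norm_remainder_le [Fact (1 < L)] (hρ : IsSpecialUnitaryModel ρ) (hRT : 1 + 1 < L)
    {β : ℝ} (hβ0 : 0 ≤ β) (hβ : β ≤ betaOne d ρ) :
    ‖remainder (d := d) (G := G) ρ L β‖ ≤ (2 * Real.exp (1 / 2)) ^ (4 * (2 ^ d * (d * d))) * (β / betaOne d ρ) ^ 2 := by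
  classical
  haveI := IsSpecialUnitaryModel.secondCountableTopology ρ hρ
  have hu := IsSpecialUnitaryModel.mem_unitaryGroup ρ hρ
  set S := torusSystem (G := G) ρ L with hS
  have hR : S.Regular (costBound ρ) (Plaq.degBound d) := torusSystem_regular ρ hρ.1
  set M := costBound ρ with hM
  set D := Plaq.degBound d with hD
  set B : Finset (ZdEdge d) := loopEdges (0 : Literature.Probability.LatticeModels.Site d) 0 1 1 1 with hB
  set F : ZdGaugeConfig d G → ℂ := obsF ρ with hF
  have hFb : ∀ U, ‖F U‖ ≤ 1 := fun U => by
    rw [hF, obsF, Complex.norm_real, Real.norm_eq_abs]; exact abs_zdWilsonLoop_le ρ hu 0 0 1 1 1 U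
  have hb1 : 0 < betaOne d ρ := betaOne_pos d (ρ := ρ)
  have hβR : PlaqSystem.betaR M D = betaOne d ρ := betaR_costBound ρ
  have hβn : ‖(β : ℂ)‖ ≤ PlaqSystem.betaR M D := by
    rw [Complex.norm_real, Real.norm_eq_abs, abs_of_nonneg hβ0, hβR]; exact hβ
  have hb1n : ‖((betaOne d ρ : ℝ) : ℂ)‖ ≤ PlaqSystem.betaR M D := by
    rw [Complex.norm_real, Real.norm_eq_abs, abs_of_pos hb1, hβR]
  have hβM : ‖(β : ℂ)‖ * M ≤ 1 := PlaqSystem.norm_mul_le_one hR hβn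
  set ε : ℝ := 2 * M * ‖(β : ℂ)‖ with hε
  set ε₁ : ℝ := 2 * M * ‖((betaOne d ρ : ℝ) : ℂ)‖ with hε₁
  set r : ℝ := β / betaOne d ρ with hr
  have hr0 : 0 ≤ r := div_nonneg hβ0 hb1.le
  have hr1 : r ≤ 1 := (div_le_one hb1).2 hβ
  have hεr : ε = r * ε₁ := by
    simp only [hε, hε₁, hr, Complex.norm_real, Real.norm_eq_abs, abs_of_nonneg hβ0, abs_of_pos hb1]
    field_simp
  have hM0 : 0 < M := costBound_pos ρ
  have hε₁0 : 0 ≤ ε₁ := by rw [hε₁]; positivity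
  set K := #(S.seedsOf B) with hK
  set T₀ := (torusGenuine d L).powerset.filter (Polymer.IsSeedConn S.Adj (S.Touches B)) with hT₀
  have hone : (1 : ℝ) ≤ 2 * Real.exp (1 / 2) := by
    have := Real.one_le_exp (by norm_num : (0 : ℝ) ≤ 1 / 2); linarith
  have hKle : K ≤ 4 * (2 ^ d * (d * d)) := by
    calc K ≤ #(Plaq.seedsOf B) := by
          have := card_seedsOf_torusSystem_le (G := G) ρ (L := L) B
          rwa [image_torusRed_loopEdges hRT] at this
      _ ≤ #B * (2 ^ d * (d * d)) := card_plaqSeedsOf_le B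
      _ ≤ 2 * (1 + 1) * (2 ^ d * (d * d)) := Nat.mul_le_mul_right _ (card_loopEdges_le 0 0 1 1 1)
      _ = 4 * (2 ^ d * (d * d)) := by ring
  have hc2 : 0 ≤ 2 ^ K * r ^ 2 := by positivity
  show ‖∑ Q₁ ∈ T₀.filter (fun Q => 2 ≤ #Q), S.aPol F Q₁ β * S.ratio (torusGenuine d L) (S.snbAll B Q₁) β‖ ≤ _
  calc ‖∑ Q₁ ∈ T₀.filter (fun Q => 2 ≤ #Q), S.aPol F Q₁ β * S.ratio (torusGenuine d L) (S.snbAll B Q₁) β‖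
      ≤ ∑ Q₁ ∈ T₀.filter (fun Q => 2 ≤ #Q), ‖S.aPol F Q₁ β * S.ratio (torusGenuine d L) (S.snbAll B Q₁) β‖ :=
        norm_sum_le _ _
    _ ≤ ∑ Q₁ ∈ T₀.filter (fun Q => 2 ≤ #Q), 2 ^ K * r ^ 2 * (ε₁ * 2 ^ D) ^ #Q₁ := by
        refine Finset.sum_le_sum fun Q₁ hQ₁ => ?_
        obtain ⟨-, hc⟩ := mem_filter.1 hQ₁
        rw [norm_mul]
        have h2 : ‖S.ratio (torusGenuine d L) (S.snbAll B Q₁) β‖ ≤ 2 ^ (K + D * #Q₁) := by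
          refine (PlaqSystem.norm_ratio_le hR hβn _ _).trans (pow_le_pow_right₀ one_le_two ?_)
          calc #(S.snbAll B Q₁) ≤ #(S.seedsOf B) + #(S.nbAll Q₁) := Finset.card_union_le _ _
            _ ≤ K + D * #Q₁ := Nat.add_le_add_left (PlaqSystem.card_nbAll_le hR Q₁) _
        have h1 : ‖S.aPol F Q₁ β‖ ≤ r ^ 2 * ε₁ ^ #Q₁ := by
          calc ‖S.aPol F Q₁ β‖ ≤ 1 * ε ^ #Q₁ := PlaqSystem.norm_aPol_le hR hFb hβM Q₁
            _ = r ^ #Q₁ * ε₁ ^ #Q₁ := by rw [one_mul, hεr, mul_pow]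
            _ ≤ r ^ 2 * ε₁ ^ #Q₁ :=
                mul_le_mul_of_nonneg_right (pow_le_pow_of_le_one hr0 hr1 hc) (pow_nonneg hε₁0 _)
        calc ‖S.aPol F Q₁ β‖ * ‖S.ratio (torusGenuine d L) (S.snbAll B Q₁) β‖
            ≤ r ^ 2 * ε₁ ^ #Q₁ * 2 ^ (K + D * #Q₁) :=
              mul_le_mul h1 h2 (norm_nonneg _) (mul_nonneg (pow_nonneg hr0 _) (pow_nonneg hε₁0 _))
          _ = 2 ^ K * r ^ 2 * (ε₁ * 2 ^ D) ^ #Q₁ := by rw [pow_add, pow_mul, mul_pow]; ring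
    _ ≤ ∑ Q₁ ∈ T₀, 2 ^ K * r ^ 2 * (ε₁ * 2 ^ D) ^ #Q₁ :=
        Finset.sum_le_sum_of_subset_of_nonneg (Finset.filter_subset _ _) fun Q₁ _ _ =>
          mul_nonneg hc2 (pow_nonneg (mul_nonneg hε₁0 (pow_nonneg zero_le_two _)) _)
    _ = 2 ^ K * r ^ 2 * ∑ Q₁ ∈ T₀, (ε₁ * 2 ^ D) ^ #Q₁ := by rw [Finset.mul_sum]
    _ ≤ 2 ^ K * r ^ 2 * Real.exp (#((torusGenuine d L).filter (S.Touches B)) * (1 / 2 : ℝ)) := by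
        refine mul_le_mul_of_nonneg_left ?_ hc2
        refine Polymer.sum_isSeedConn_pow_card_le (adj := S.Adj) (s := S.Touches B)
          (mul_nonneg hε₁0 (pow_nonneg zero_le_two _)) (torusGenuine d L) fun t _ => ?_
        have := PlaqSystem.sum_isConn_eps_le hR hb1n (torusGenuine d L) t
        simpa only [hε₁] using this
    _ ≤ 2 ^ K * r ^ 2 * Real.exp (K * (1 / 2 : ℝ)) := by
        refine mul_le_mul_of_nonneg_left (Real.exp_le_exp.2 ?_) hc2
        refine mul_le_mul_of_nonneg_right ?_ (by norm_num)
        exact_mod_cast Finset.card_le_card (S.filter_touches_subset B _)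
    _ = (2 * Real.exp (1 / 2)) ^ K * r ^ 2 := by
        rw [mul_pow, ← Real.exp_nat_mul, mul_right_comm]
    _ ≤ (2 * Real.exp (1 / 2)) ^ (4 * (2 ^ d * (d * d))) * r ^ 2 :=
        mul_le_mul_of_nonneg_right (pow_le_pow_right₀ hone hKle) (pow_nonneg hr0 _)

/-! ### The expansion of the plaquette expectation: main term and remainder -/

omit [Group G] [TopologicalSpace G] [IsTopologicalGroup G] [CompactSpace G] [MeasurableSpace G]
  [BorelSpace G] [NeZero L] in
/-- The bond `(0, 0)` lies on the unit loop at the origin. [folklore] -/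
theorem zero_mem_loopEdges :
    ((0 : Literature.Probability.LatticeModels.Site d), (0 : Fin d)) ∈
      loopEdges (0 : Literature.Probability.LatticeModels.Site d) 0 1 1 1 := by
  unfold loopEdges
  refine mem_union_left _ (mem_union_left _ (mem_union_left _ ?_))
  exact mem_lineEdges_iff.2 ⟨0, one_pos, by simp⟩

omit [Group G] [TopologicalSpace G] [IsTopologicalGroup G] [CompactSpace G] [MeasurableSpace G]
  [BorelSpace G] [NeZero L] in
/-- The bond `(0, 0)` is a bond of the origin plaquette. [folklore] -/
theorem zero_mem_bonds_p₀ :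
    ((0 : Literature.Probability.LatticeModels.Site d), (0 : Fin d)) ∈ (p₀ : Plaq d).bonds := by
  simp [p₀, Plaq.bonds]

/-- **Lower bound for the torus plaquette expectation in the polymer representation**:
for `0 ≤ β ≤ β₁` and `L ≥ 3`,
`Re ⟨W_{1×1}⟩^T_L(β) ≥ N⁻¹ β e^{-2βN} V₀ - (2e^{1/2})^{4·2^d d²} (β/β₁)²`
(main term `aPol W {p} · R ≥ N⁻¹ m(β)` since `R ≥ 1`, the other singletons and `∅` vanish, and the
remainder is `O(β²)`). [folklore] -/
theorem re_expect_obsF_ge [Fact (1 < L)] (hρ : IsSpecialUnitaryModel ρ) (hN : 2 ≤ N)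
    (h01 : (0 : Fin d) ≠ 1) (hL : 1 + 1 < L) {β : ℝ} (hβ0 : 0 ≤ β) (hβ : β ≤ betaOne d ρ) :
    (N : ℝ)⁻¹ * (β * Real.exp (-(2 * β * N)) * charVariance ρ) -
        (2 * Real.exp (1 / 2)) ^ (4 * (2 ^ d * (d * d))) * (β / betaOne d ρ) ^ 2 ≤
      ((torusSystem ρ L).expect (obsF ρ) (torusGenuine d L) β).re := by
  classical
  haveI := IsSpecialUnitaryModel.secondCountableTopology ρ hρ
  have hu := IsSpecialUnitaryModel.mem_unitaryGroup ρ hρ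
  have hL2 : 2 ≤ L := by omega
  set S := torusSystem (G := G) ρ L with hS
  have hR : S.Regular (costBound ρ) (Plaq.degBound d) := torusSystem_regular ρ hρ.1
  set B : Finset (ZdEdge d) := loopEdges (0 : Literature.Probability.LatticeModels.Site d) 0 1 1 1 with hB
  set F : ZdGaugeConfig d G → ℂ := obsF ρ with hF
  have hFm : Measurable F :=
    Complex.measurable_ofReal.comp (continuous_zdWilsonLoop ρ hρ.1 0 0 1 1 1).measurable
  have hFb : ∀ U, ‖F U‖ ≤ 1 := fun U => by
    rw [hF, obsF, Complex.norm_real, Real.norm_eq_abs]; exact abs_zdWilsonLoop_le ρ hu 0 0 1 1 1 U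
  have hFB : DependsOn F (B : Set (ZdEdge d)) := fun U V h => by
    simp only [hF, obsF, dependsOn_zdWilsonLoop (ρ := ρ) 0 0 1 1 1 h]
  set T₀ := (torusGenuine d L).powerset.filter (Polymer.IsSeedConn S.Adj (S.Touches B)) with hT₀
  -- the origin plaquette is a genuine torus plaquette touching the loop
  have hpTgen : torusProj L (p₀ : Plaq d) ∈ torusGenuine d L := by
    rw [mem_torusGenuine, torusProj_p₀]
    exact (Fin.pos_iff_ne_zero' (1 : Fin d)).2 h01.symm
  have hbond : ((0 : Literature.Probability.LatticeModels.Site d), (0 : Fin d)) ∈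
      (torusSystem (G := G) ρ L).bonds (torusProj L (p₀ : Plaq d)) := by
    rw [torusSystem_bonds_torusProj, Finset.mem_image]
    exact ⟨_, zero_mem_bonds_p₀, torusRed_eq_self_of_mem_bonds_p₀ hL2 zero_mem_bonds_p₀⟩
  have htouch : S.Touches B (torusProj L (p₀ : Plaq d)) :=
    Finset.not_disjoint_iff.2 ⟨_, hbond, zero_mem_loopEdges⟩
  have hmem : ({torusProj L (p₀ : Plaq d)} : Finset (TPlaq d L)) ∈ T₀.filter (fun Q => ¬ 2 ≤ #Q) := by
    refine mem_filter.2 ⟨mem_filter.2 ⟨mem_powerset.2 (singleton_subset_iff.2 hpTgen), ?_⟩, by simp⟩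
    intro b hb
    refine ⟨torusProj L (p₀ : Plaq d), mem_singleton_self _, htouch, ?_⟩
    rw [mem_singleton.1 hb]
    exact Polymer.Reach.refl _
  have hzero : ∀ Q ∈ T₀.filter (fun Q => ¬ 2 ≤ #Q), Q ≠ {torusProj L (p₀ : Plaq d)} →
      S.aPol F Q β * S.ratio (torusGenuine d L) (S.snbAll B Q) β = 0 := by
    intro Q hQ hne
    obtain ⟨hQ', hcard⟩ := mem_filter.1 hQ
    have hQV : Q ⊆ torusGenuine d L := mem_powerset.1 (mem_filter.1 hQ').1
    have hc1 : #Q ≤ 1 := by omega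
    obtain ⟨q, hq⟩ := Finset.card_le_one_iff_subset_singleton.1 hc1
    rcases Finset.subset_singleton_iff.1 hq with rfl | rfl
    · refine mul_eq_zero_of_left ?_ _
      rw [PlaqSystem.aPol_empty, hF]
      simp only [obsF]
      rw [integral_complex_ofReal, integral_zdWilsonLoop_one_one_eq_zero ρ hρ hN h01,
        Complex.ofReal_zero]
    · have hqV : q ∈ torusGenuine d L := hQV (mem_singleton_self q)
      have hqne : q ≠ torusProj L (p₀ : Plaq d) := fun h => hne (by rw [h])
      exact mul_eq_zero_of_left
        (aPol_singleton_eq_zero ρ hρ hN h01 β (mem_torusGenuine.1 hqV) hqne) _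
  -- the main term
  have hmain : (N : ℝ)⁻¹ * (β * Real.exp (-(2 * β * N)) * charVariance ρ) ≤
      (∑ Q₁ ∈ T₀.filter (fun Q => ¬ 2 ≤ #Q),
        S.aPol F Q₁ β * S.ratio (torusGenuine d L) (S.snbAll B Q₁) β).re := by
    obtain ⟨r, hr1, hr⟩ :=
      exists_ratio_eq_ofReal ρ hρ.1 hu hβ0 (torusGenuine d L) (S.snbAll B {torusProj L (p₀ : Plaq d)})
    have hr' : S.ratio (torusGenuine d L) (S.snbAll B {torusProj L (p₀ : Plaq d)}) β = (r : ℂ) := hr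
    have ha' : S.aPol F {torusProj L (p₀ : Plaq d)} β = ((((N : ℝ)⁻¹ * tiltedMoment ρ β : ℝ)) : ℂ) :=
      aPol_singleton_self ρ hρ.1 h01 hL2 β
    rw [Finset.sum_eq_single_of_mem _ hmem hzero, hr', ha', ← Complex.ofReal_mul, Complex.ofReal_re]
    have hm : β * Real.exp (-(2 * β * N)) * charVariance ρ ≤ tiltedMoment ρ β :=
      tiltedMoment_ge ρ hρ hN hβ0
    have hV : 0 < charVariance ρ := charVariance_pos ρ hρ.1 (by omega)
    have hm0 : 0 ≤ tiltedMoment ρ β := le_trans (by positivity) hm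
    calc (N : ℝ)⁻¹ * (β * Real.exp (-(2 * β * N)) * charVariance ρ)
        ≤ (N : ℝ)⁻¹ * tiltedMoment ρ β := mul_le_mul_of_nonneg_left hm (by positivity)
      _ = (N : ℝ)⁻¹ * tiltedMoment ρ β * 1 := (mul_one _).symm
      _ ≤ (N : ℝ)⁻¹ * tiltedMoment ρ β * r := mul_le_mul_of_nonneg_left hr1 (by positivity)
  -- the remainder
  have hrem : -((2 * Real.exp (1 / 2)) ^ (4 * (2 ^ d * (d * d))) * (β / betaOne d ρ) ^ 2) ≤
      (∑ Q₁ ∈ T₀.filter (fun Q => 2 ≤ #Q),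
        S.aPol F Q₁ β * S.ratio (torusGenuine d L) (S.snbAll B Q₁) β).re := by
    have h1 := norm_remainder_le (L := L) ρ hρ hL hβ0 hβ
    have h2 := (abs_le.1 (Complex.abs_re_le_norm (remainder (d := d) (G := G) ρ L β))).1
    exact le_trans (neg_le_neg h1) h2
  rw [PlaqSystem.expect_eq_sum hR hFm hFb hFB (torusGenuine d L) (β : ℂ),
    ← Finset.sum_filter_add_sum_filter_not _ (fun Q => 2 ≤ #Q), Complex.add_re]
  refine le_trans (le_of_eq (by ring)) (add_le_add hrem hmain)

end Terms

/-! ### The plaquette expectation on large tori and in the infinite volume -/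

section Assembly

variable [NeZero d] [Group G] [TopologicalSpace G] [IsTopologicalGroup G] [CompactSpace G]
  [MeasurableSpace G] [BorelSpace G] (ρ : G →* Matrix (Fin N) (Fin N) ℂ)

/-- **Lower bound for the torus plaquette expectation**, uniformly in the volume: for
`G = SU(N)`, `N ≥ 2`, `0 ≤ β ≤ β₁` and all `L ≥ 2`,
`⟨W_{1×1}⟩_{Λ_{L+1}, β} ≥ N⁻¹ β e^{-2βN} V₀ - (2e^{1/2})^{4·2^d d²} (β/β₁)²`. [folklore] -/
theorem wilsonExpectation_plaquette_ge (hρ : IsSpecialUnitaryModel ρ) (hN : 2 ≤ N)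
    (h01 : (0 : Fin d) ≠ 1) {L : ℕ} (hL : 2 ≤ L) {β : ℝ} (hβ0 : 0 ≤ β) (hβ : β ≤ betaOne d ρ) :
    (N : ℝ)⁻¹ * (β * Real.exp (-(2 * β * N)) * charVariance ρ) -
        (2 * Real.exp (1 / 2)) ^ (4 * (2 ^ d * (d * d))) * (β / betaOne d ρ) ^ 2 ≤
      wilsonExpectation (L := L + 1) ρ β (wilsonLoop ρ (0 : Site d (L + 1)) 0 1 1 1) := by
  haveI := IsSpecialUnitaryModel.secondCountableTopology ρ hρ
  haveI : Fact (1 < L + 1) := ⟨by omega⟩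
  have hu := IsSpecialUnitaryModel.mem_unitaryGroup ρ hρ
  have h0 : Literature.Probability.LatticeModels.Torus.proj (L + 1)
      (0 : Literature.Probability.LatticeModels.Site d) = (0 : Site d (L + 1)) := by
    funext k; simp [Literature.Probability.LatticeModels.Torus.proj]
  have hW : wilsonLoop ρ (0 : Site d (L + 1)) 0 1 1 1 = toTorusObservable (L + 1)
      (zdWilsonLoop ρ (0 : Literature.Probability.LatticeModels.Site d) 0 1 1 1) := by
    funext U
    rw [toTorusObservable_apply, zdWilsonLoop_torusLift, h0]
  have hFm : Measurable (zdWilsonLoop ρ (0 : Literature.Probability.LatticeModels.Site d) 0 1 1 1) :=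
    (continuous_zdWilsonLoop ρ hρ.1 0 0 1 1 1).measurable
  have hFb : ∀ U, |zdWilsonLoop ρ (0 : Literature.Probability.LatticeModels.Site d) 0 1 1 1 U| ≤ 1 :=
    abs_zdWilsonLoop_le ρ hu 0 0 1 1 1
  rw [hW, wilsonExpectation_toTorusObservable_eq_re_expect ρ hρ.1 β hFm hFb]
  have hobs : (fun U : ZdGaugeConfig d G =>
      ((zdWilsonLoop ρ 0 0 1 1 1 (U ∘ torusRed (L + 1)) : ℝ) : ℂ)) = obsF ρ := by
    funext U; rw [obsF, zdWilsonLoop_comp_torusRed ρ (by omega) U]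
  rw [hobs]
  exact re_expect_obsF_ge ρ hρ hN h01 (by omega) hβ0 hβ

/-- **The plaquette expectation of every strong-coupling limit state is bounded below linearly
in `β`**: for `G = SU(N)`, `N ≥ 2`, `d ≥ 2` there are `0 < β₂ ≤ β₁` and `c > 0` with
`W_μ(1,1) ≥ c β` for all `0 < β ≤ β₂` and all `μ ∈ infiniteVolumeLimitPoints ρ β`
(leading order of the strong-coupling expansion, Osterwalder–Seiler 1978 §3; Montvay–Münster
(3.101)). [folklore] -/
theorem exists_rectExpectation_one_one_ge (hρ : IsSpecialUnitaryModel ρ) (hN : 2 ≤ N) (hd : 2 ≤ d) :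
    ∃ β₂ c : ℝ, 0 < β₂ ∧ β₂ ≤ betaOne d ρ ∧ 0 < c ∧ ∀ β : ℝ, 0 < β → β ≤ β₂ →
      ∀ μ ∈ infiniteVolumeLimitPoints (d := d) ρ β,
        c * β ≤ rectExpectation μ (fun g => normalisedCharacter N (ρ g)) 0 1 1 1 := by
  have hb1 : 0 < betaOne d ρ := betaOne_pos d (ρ := ρ)
  have hN0 : (0 : ℝ) < N := by exact_mod_cast (show 0 < N by omega)
  have hV : 0 < charVariance ρ := charVariance_pos ρ hρ.1 (by omega)
  obtain ⟨Kc, hKc⟩ : ∃ Kc : ℝ, Kc = (2 * Real.exp (1 / 2)) ^ (4 * (2 ^ d * (d * d))) := ⟨_, rfl⟩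
  have hKc0 : 0 < Kc := by rw [hKc]; positivity
  obtain ⟨A, hA⟩ : ∃ A : ℝ, A = (N : ℝ)⁻¹ * charVariance ρ * Real.exp (-1) := ⟨_, rfl⟩
  have hA0 : 0 < A := by rw [hA]; positivity
  obtain ⟨B, hB⟩ : ∃ B : ℝ, B = A * betaOne d ρ ^ 2 / (2 * Kc) := ⟨_, rfl⟩
  have hB0 : 0 < B := by rw [hB]; positivity
  refine ⟨min (betaOne d ρ) (min (1 / (2 * N)) B), A / 2, lt_min hb1 (lt_min (by positivity) hB0),
    min_le_left _ _, by positivity, fun β hβ0 hβ μ hμ => ?_⟩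
  have hβ1 : β ≤ betaOne d ρ := hβ.trans (min_le_left _ _)
  have hβN : β ≤ 1 / (2 * N) := hβ.trans ((min_le_right _ _).trans (min_le_left _ _))
  have hβB : β ≤ B := hβ.trans ((min_le_right _ _).trans (min_le_right _ _))
  refine le_rectExpectation_of_eventually ρ hρ.1 hμ ?_
  filter_upwards [eventually_ge_atTop 2] with L hL
  refine le_trans ?_
    (wilsonExpectation_plaquette_ge ρ hρ hN (TorusAreaLaw.fin_zero_ne_one hd) hL hβ0.le hβ1)
  rw [← hKc]
  have h1 : Real.exp (-1) ≤ Real.exp (-(2 * β * N)) := by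
    refine Real.exp_le_exp.2 ?_
    have : β * (2 * N) ≤ 1 := by rwa [le_div_iff₀ (by positivity)] at hβN
    linarith
  have h2 : Kc * (β / betaOne d ρ) ^ 2 ≤ A / 2 * β := by
    have e : Kc * (β / betaOne d ρ) ^ 2 = Kc / betaOne d ρ ^ 2 * β * β := by ring
    rw [e]
    refine mul_le_mul_of_nonneg_right ?_ hβ0.le
    calc Kc / betaOne d ρ ^ 2 * β ≤ Kc / betaOne d ρ ^ 2 * B :=
          mul_le_mul_of_nonneg_left hβB (by positivity)
      _ = A / 2 := by rw [hB]; field_simp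
  have h3 : A * β ≤ (N : ℝ)⁻¹ * (β * Real.exp (-(2 * β * N)) * charVariance ρ) := by
    have e : (N : ℝ)⁻¹ * (β * Real.exp (-(2 * β * N)) * charVariance ρ) =
        (N : ℝ)⁻¹ * charVariance ρ * Real.exp (-(2 * β * N)) * β := by ring
    rw [e, hA]
    refine mul_le_mul_of_nonneg_right ?_ hβ0.le
    exact mul_le_mul_of_nonneg_left h1 (by positivity)
  linarith

end Assembly

end PlaquetteLowerBound

end Literature.MathematicalPhysics.QuantumFieldTheory
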